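import Summits.Ventures.PercRepro.Night2SeriesClassesBases
import Summits.Ventures.PercRepro.Night2SeriesClassFourCellsB

/-!
# PercRepro — the series-class cells `[3, 3]` and `[3, 2, 2]` of `(3, 0)` at `|G| = 11` (night-2, gen 23)

With the general series-class count `card_coverBases_le_cntSeries` and the chord `8/27`: two disjoint triangles of
2-cocircuits (`localShadowHall_three_zero_six_eleven_of_twoTriangles`, classes `[3, 3]`, count sum
`15244497/12311992 = 1.238`) and a triangle with two further pairs, all three pairwise disjoint
(`localShadowHall_three_zero_six_eleven_of_triangleTwoPairs`, `[3, 2, 2]`, `505161/447304 = 1.129`); `cntSeries` is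
evaluated at the concrete sizes by `norm_num [cntSeries, …]`.  These are the two configurations left at `|G| = 11`
with five or more fat thin closures (`Night2SeriesClassesCellsB` assembles them into the closure of the cell).
-/

namespace PercRepro.Shadow

open Finset PerFlat ThmH

/-- The count sum of the cell `(3, 0)` at `n = 11` with the series classes `[3, 3]` and `E = 8 / 27`: `1.238 ≥ 1`. -/
theorem countSum_three_zero_eleven_33 :
    1 ≤ countSum 11 6 3 (cPrimeDGP 5 3 6 0 2) (8 / 27 : ℚ) (fun s => (cntSeries 6 s [3, 3] : ℚ)) := by
  rw [cPrimeDGP_three_zero_two]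
  unfold countSum DGenP.cjG
  rw [show Finset.Icc 1 (11 - 6) = {1, 2, 3, 4, 5} by decide]
  repeat rw [Finset.sum_insert (by decide)]
  rw [Finset.sum_singleton]
  norm_num [cntSeries, Nat.choose_eq_descFactorial_div_factorial, Nat.descFactorial, Nat.factorial]

/-- The count sum of the cell `(3, 0)` at `n = 11` with the series classes `[3, 2, 2]` and `E = 8 / 27`: `1.129 ≥ 1`. -/
theorem countSum_three_zero_eleven_322 :
    1 ≤ countSum 11 6 3 (cPrimeDGP 5 3 6 0 2) (8 / 27 : ℚ) (fun s => (cntSeries 6 s [3, 2, 2] : ℚ)) := by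
  rw [cPrimeDGP_three_zero_two]
  unfold countSum DGenP.cjG
  rw [show Finset.Icc 1 (11 - 6) = {1, 2, 3, 4, 5} by decide]
  repeat rw [Finset.sum_insert (by decide)]
  rw [Finset.sum_singleton]
  norm_num [cntSeries, Nat.choose_eq_descFactorial_div_factorial, Nat.descFactorial, Nat.factorial]

/-- `cntSeries 6 s [3, 3] > 0` for `7 ≤ s ≤ 11`. -/
theorem cntSeries_33_pos : ∀ s, 7 ≤ s → s ≤ 11 → 0 < (cntSeries 6 s [3, 3] : ℚ) := by
  intro s h1 h2
  interval_cases s <;> norm_num [cntSeries, Nat.choose_eq_descFactorial_div_factorial, Nat.descFactorial, Nat.factorial]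

/-- `cntSeries 6 s [3, 2, 2] > 0` for `7 ≤ s ≤ 11`. -/
theorem cntSeries_322_pos : ∀ s, 7 ≤ s → s ≤ 11 → 0 < (cntSeries 6 s [3, 2, 2] : ℚ) := by
  intro s h1 h2
  interval_cases s <;> norm_num [cntSeries, Nat.choose_eq_descFactorial_div_factorial, Nat.descFactorial, Nat.factorial]

variable {α : Type*} [DecidableEq α] {M : Matroid α} [M.Finite]

omit [M.Finite] in
/-- The pairs of a triangle of 2-cocircuits are 2-cocircuits (in either order). -/
theorem triangle_cocircuits {q : ℕ} {G : Finset α} {p x y : α}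
    (hH₀ : M.eRk ((G \ {p, x} : Finset α) : Set α) ≤ (q : ℕ∞))
    (hH₁ : M.eRk ((G \ {p, y} : Finset α) : Set α) ≤ (q : ℕ∞))
    (hH₂ : M.eRk ((G \ {x, y} : Finset α) : Set α) ≤ (q : ℕ∞)) :
    ∀ a ∈ ({p, x, y} : Finset α), ∀ b ∈ ({p, x, y} : Finset α), a ≠ b →
      M.eRk ((G \ {a, b} : Finset α) : Set α) ≤ (q : ℕ∞) := by
  have comm : ∀ {u v : α}, M.eRk ((G \ {u, v} : Finset α) : Set α) ≤ (q : ℕ∞) →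
      M.eRk ((G \ {v, u} : Finset α) : Set α) ≤ (q : ℕ∞) := by
    intro u v h; rwa [Finset.pair_comm]
  intro a ha b hb hab
  simp only [Finset.mem_insert, Finset.mem_singleton] at ha hb
  rcases ha with rfl | rfl | rfl <;> rcases hb with rfl | rfl | rfl <;>
    first
    | exact absurd rfl hab
    | exact hH₀ | exact hH₁ | exact hH₂ | exact comm hH₀ | exact comm hH₁ | exact comm hH₂

open scoped Classical in
/-- **The cell `(3, 0)` at `|G| = 11` with two disjoint triangles of 2-cocircuits**: (LI_G) through the series-class count `[3, 3]` and the chord `8/27`. -/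
theorem localShadowHall_three_zero_six_eleven_of_twoTriangles {G : Finset α} (hG : G ∈ flatsQ M (5 + 1))
    (hd : (gr M \ G).card = 3) (hk : kColoops M G = 0)
    (hs : ∀ e ∈ gr M, ∀ f ∈ gr M, e ≠ f → rkN M {e, f} = 2) (hl : ∀ e ∈ gr M, M.Indep {e})
    (hn : G.card = 11) {p x y u v w : α}
    (hpx : p ≠ x) (hpy : p ≠ y) (hxy : x ≠ y) (huv : u ≠ v) (huw : u ≠ w) (hvw : v ≠ w)
    (hdisj : Disjoint ({p, x, y} : Finset α) {u, v, w})
    (hH₀ : M.eRk ((G \ {p, x} : Finset α) : Set α) ≤ ((5 : ℕ) : ℕ∞))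
    (hH₁ : M.eRk ((G \ {p, y} : Finset α) : Set α) ≤ ((5 : ℕ) : ℕ∞))
    (hH₂ : M.eRk ((G \ {x, y} : Finset α) : Set α) ≤ ((5 : ℕ) : ℕ∞))
    (hH₃ : M.eRk ((G \ {u, v} : Finset α) : Set α) ≤ ((5 : ℕ) : ℕ∞))
    (hH₄ : M.eRk ((G \ {u, w} : Finset α) : Set α) ≤ ((5 : ℕ) : ℕ∞))
    (hH₅ : M.eRk ((G \ {v, w} : Finset α) : Set α) ≤ ((5 : ℕ) : ℕ∞)) :
    LocalShadowHall M 5 G := by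
  have hk' : kColoops M G + 6 = 5 + 1 := by omega
  have hd' : (gr M \ G).card ≤ 5 := by omega
  have hm2 : ∀ B ∈ thinMembers M 5 G, 6 ≤ (B \ coloops M G).card → 2 ≤ (G \ clF M B).card :=
    fun B hB _ => two_le_card_sdiff_of_not_lay0 hG hd' (mem_thinMembers.1 hB).1 (mem_thinMembers.1 hB).2
  have hc2 : 0 ≤ cPrimeDGP 5 3 6 (kColoops M G) 2 := by
    rw [hk]; unfold cPrimeDGP capDG reqDGP phiQ; norm_num
  have hn' : G.card - kColoops M G = 11 := by omega
  have hKG : coloops M G ⊆ G := fun y hy => (mem_coloops.1 hy).1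
  have hnK : (G \ coloops M G).card = 11 := by
    rw [Finset.card_sdiff_of_subset hKG, ← kColoops_eq_card_coloops]; omega
  have hKempty : coloops M G = ∅ := by
    rw [kColoops_eq_card_coloops] at hk
    exact Finset.card_eq_zero.1 hk
  refine localShadowHall_excess_of_count (d := 3) (ρ := 6) (m₁ := 2) hG hd (by norm_num) hk' (by norm_num)
    hs hl hc2 hm2 (E := (8 / 27 : ℚ)) (by norm_num) ?_ (cnt := fun s => (cntSeries 6 s [3, 3] : ℚ)) ?_ ?_ ?_
  · intro S _ T hT
    have hT' : T ∈ (S \ coloops M G).powersetCard 6 := by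
      unfold coverBases at hT
      exact (Finset.mem_filter.1 hT).1
    have h := sum_faceLoss_union_le (a := (11 / 45 : ℚ)) (b := (1 / 45 : ℚ)) hG hd (by norm_num) hk' (by omega)
      hs hl (by norm_num) (by rw [hnK]; intro m h1 h2; exact DGenP.chord_three_zero_11 m h1 (by omega))
      (by rw [hnK, hk, DGenP.excessBound_three_zero_11]; norm_num) hT'
    rw [hnK, hk, DGenP.excessBound_three_zero_11] at h
    exact h
  · intro s h1 h2
    rw [hn'] at h2
    exact cntSeries_33_pos s h1 (by omega)
  · intro S hSG
    have := card_coverBases_le_cntSeries hk' ([({p, x, y} : Finset α), {u, v, w}]) ?_ ?_ ?_ hSG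
    · have e1 : ({p, x, y} : Finset α).card = 3 := by
        rw [Finset.card_insert_of_notMem (by simp [hpx, hpy]), Finset.card_pair hxy]
      have e2 : ({u, v, w} : Finset α).card = 3 := by
        rw [Finset.card_insert_of_notMem (by simp [huv, huw]), Finset.card_pair hvw]
      simp only [List.map_cons, List.map_nil, e1, e2] at this
      exact this
    · -- pairwise disjoint
      rw [List.pairwise_cons, List.pairwise_cons]
      refine ⟨?_, ?_, List.Pairwise.nil⟩
      · intro C hC
        rw [List.mem_singleton] at hC
        rw [hC]; exact hdisj
      · intro C hC; exact absurd hC List.not_mem_nil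
    · -- nonempty
      intro C hC
      simp only [List.mem_cons, List.not_mem_nil, or_false] at hC
      rcases hC with rfl | rfl
      · rw [Finset.card_insert_of_notMem (by simp [hpx, hpy]), Finset.card_pair hxy]; omega
      · rw [Finset.card_insert_of_notMem (by simp [huv, huw]), Finset.card_pair hvw]; omega
    · -- the cocircuits
      intro C hC a ha b hb hab
      refine ⟨by rw [hKempty]; exact Finset.empty_subset _, ?_⟩
      simp only [List.mem_cons, List.not_mem_nil, or_false] at hC
      rcases hC with rfl | rfl
      · exact triangle_cocircuits hH₀ hH₁ hH₂ a ha b hb hab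
      · exact triangle_cocircuits hH₃ hH₄ hH₅ a ha b hb hab
  · rw [hn', hk]
    exact countSum_three_zero_eleven_33

open scoped Classical in
/-- **The cell `(3, 0)` at `|G| = 11` with a triangle of 2-cocircuits and two further pairs, all three pairwise disjoint**: (LI_G) through the series-class count `[3, 2, 2]` and the chord `8/27`. -/
theorem localShadowHall_three_zero_six_eleven_of_triangleTwoPairs {G : Finset α} (hG : G ∈ flatsQ M (5 + 1))
    (hd : (gr M \ G).card = 3) (hk : kColoops M G = 0)
    (hs : ∀ e ∈ gr M, ∀ f ∈ gr M, e ≠ f → rkN M {e, f} = 2) (hl : ∀ e ∈ gr M, M.Indep {e})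
    (hn : G.card = 11) {p x y u v u' v' : α}
    (hpx : p ≠ x) (hpy : p ≠ y) (hxy : x ≠ y) (huv : u ≠ v) (huv' : u' ≠ v')
    (hd₁ : Disjoint ({p, x, y} : Finset α) {u, v}) (hd₂ : Disjoint ({p, x, y} : Finset α) {u', v'})
    (hd₃ : Disjoint ({u, v} : Finset α) {u', v'})
    (hH₀ : M.eRk ((G \ {p, x} : Finset α) : Set α) ≤ ((5 : ℕ) : ℕ∞))
    (hH₁ : M.eRk ((G \ {p, y} : Finset α) : Set α) ≤ ((5 : ℕ) : ℕ∞))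
    (hH₂ : M.eRk ((G \ {x, y} : Finset α) : Set α) ≤ ((5 : ℕ) : ℕ∞))
    (hH₃ : M.eRk ((G \ {u, v} : Finset α) : Set α) ≤ ((5 : ℕ) : ℕ∞))
    (hH₄ : M.eRk ((G \ {u', v'} : Finset α) : Set α) ≤ ((5 : ℕ) : ℕ∞)) :
    LocalShadowHall M 5 G := by
  have hk' : kColoops M G + 6 = 5 + 1 := by omega
  have hd' : (gr M \ G).card ≤ 5 := by omega
  have hm2 : ∀ B ∈ thinMembers M 5 G, 6 ≤ (B \ coloops M G).card → 2 ≤ (G \ clF M B).card :=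
    fun B hB _ => two_le_card_sdiff_of_not_lay0 hG hd' (mem_thinMembers.1 hB).1 (mem_thinMembers.1 hB).2
  have hc2 : 0 ≤ cPrimeDGP 5 3 6 (kColoops M G) 2 := by
    rw [hk]; unfold cPrimeDGP capDG reqDGP phiQ; norm_num
  have hn' : G.card - kColoops M G = 11 := by omega
  have hKG : coloops M G ⊆ G := fun y hy => (mem_coloops.1 hy).1
  have hnK : (G \ coloops M G).card = 11 := by
    rw [Finset.card_sdiff_of_subset hKG, ← kColoops_eq_card_coloops]; omega
  have hKempty : coloops M G = ∅ := by
    rw [kColoops_eq_card_coloops] at hk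
    exact Finset.card_eq_zero.1 hk
  refine localShadowHall_excess_of_count (d := 3) (ρ := 6) (m₁ := 2) hG hd (by norm_num) hk' (by norm_num)
    hs hl hc2 hm2 (E := (8 / 27 : ℚ)) (by norm_num) ?_ (cnt := fun s => (cntSeries 6 s [3, 2, 2] : ℚ)) ?_ ?_ ?_
  · intro S _ T hT
    have hT' : T ∈ (S \ coloops M G).powersetCard 6 := by
      unfold coverBases at hT
      exact (Finset.mem_filter.1 hT).1
    have h := sum_faceLoss_union_le (a := (11 / 45 : ℚ)) (b := (1 / 45 : ℚ)) hG hd (by norm_num) hk' (by omega)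
      hs hl (by norm_num) (by rw [hnK]; intro m h1 h2; exact DGenP.chord_three_zero_11 m h1 (by omega))
      (by rw [hnK, hk, DGenP.excessBound_three_zero_11]; norm_num) hT'
    rw [hnK, hk, DGenP.excessBound_three_zero_11] at h
    exact h
  · intro s h1 h2
    rw [hn'] at h2
    exact cntSeries_322_pos s h1 (by omega)
  · intro S hSG
    have := card_coverBases_le_cntSeries hk' ([({p, x, y} : Finset α), {u, v}, {u', v'}]) ?_ ?_ ?_ hSG
    · have e1 : ({p, x, y} : Finset α).card = 3 := by
        rw [Finset.card_insert_of_notMem (by simp [hpx, hpy]), Finset.card_pair hxy]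
      have e2 : ({u, v} : Finset α).card = 2 := Finset.card_pair huv
      have e3 : ({u', v'} : Finset α).card = 2 := Finset.card_pair huv'
      simp only [List.map_cons, List.map_nil, e1, e2, e3] at this
      exact this
    · -- pairwise disjoint
      rw [List.pairwise_cons, List.pairwise_cons, List.pairwise_cons]
      refine ⟨?_, ?_, ?_, List.Pairwise.nil⟩
      · intro C hC
        simp only [List.mem_cons, List.not_mem_nil, or_false] at hC
        rcases hC with rfl | rfl
        · exact hd₁
        · exact hd₂
      · intro C hC
        rw [List.mem_singleton] at hC
        rw [hC]; exact hd₃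
      · intro C hC; exact absurd hC List.not_mem_nil
    · -- nonempty
      intro C hC
      simp only [List.mem_cons, List.not_mem_nil, or_false] at hC
      rcases hC with rfl | rfl | rfl
      · rw [Finset.card_insert_of_notMem (by simp [hpx, hpy]), Finset.card_pair hxy]; omega
      · rw [Finset.card_pair huv]; omega
      · rw [Finset.card_pair huv']; omega
    · -- the cocircuits
      have comm : ∀ {a b : α}, M.eRk ((G \ {a, b} : Finset α) : Set α) ≤ ((5 : ℕ) : ℕ∞) →
          M.eRk ((G \ {b, a} : Finset α) : Set α) ≤ ((5 : ℕ) : ℕ∞) := by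
        intro a b h; rwa [Finset.pair_comm]
      intro C hC a ha b hb hab
      refine ⟨by rw [hKempty]; exact Finset.empty_subset _, ?_⟩
      simp only [List.mem_cons, List.not_mem_nil, or_false] at hC
      rcases hC with rfl | rfl | rfl
      · exact triangle_cocircuits hH₀ hH₁ hH₂ a ha b hb hab
      · simp only [Finset.mem_insert, Finset.mem_singleton] at ha hb
        rcases ha with rfl | rfl <;> rcases hb with rfl | rfl
        · exact absurd rfl hab
        · exact hH₃
        · exact comm hH₃
        · exact absurd rfl hab
      · simp only [Finset.mem_insert, Finset.mem_singleton] at ha hb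
        rcases ha with rfl | rfl <;> rcases hb with rfl | rfl
        · exact absurd rfl hab
        · exact hH₄
        · exact comm hH₄
        · exact absurd rfl hab
  · rw [hn', hk]
    exact countSum_three_zero_eleven_322

end PercRepro.Shadow
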